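import Mathlib
import HarnessLib
import Summits.HubbardSuperconductivity.HubbardSuperconductivity.Theorems.KLProgrammeKLRegimeEngineTowerLevUnitsDefs
import Summits.HubbardSuperconductivity.HubbardSuperconductivity.Theorems.KLProgrammeKLRegimeEngineTowerModelDefsRate
import Summits.HubbardSuperconductivity.HubbardSuperconductivity.Theorems.KLProgrammeKLRegimeEngineTowerRemeasureWt

/-!
# Route `KLProgramme` — crux K3 ENGINE (stmt-HubbardSuperconductivity-20437 `KLRegimeEngineV17F2`), stub (b) v2, THE LEVELS PACKAGE (ℓ):
# THE LEVELLED MEASURED ARRAY OF A BLOCK's INPUT FROM PLAIN (WEIGHTED) ONE-PINNED SUMS AT ITS INPUT FAMILY — the BASE row of the re-based tower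
# («(ℓ)-BASE-LEV», cure (A″) of the located «(ℓ)-BLOCK0-LOGM»; cell gate-hubbard-kl, seat hubbard-kl-k3c2-p3 g13; KL STATUS 2026-08-28 ≈21:00Z)

The trivial-family lattice norms of `𝒱_0` are not M-uniform («(ℓ)-BLOCK0-LOGM»: the `2M`-frequency fields sampled off the lattice times give Dirichlet kernels,
`ε·cc_t ≥ (2/π)ln M`), so the levelled tower is to START at `𝒱_d` read at `F_{d−1}` — block `1`'s input — whose sizes a ONE-STEP grid integration with cutoff
`Λ_d` supplies as PLAIN (or `klScaleWt`-weighted) one-pinned sums at the family `F_{d−1}` (p3's generic-cutoff grid step).  This file turns such plain data into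
the LEVELLED measured array the kit reads, at the cost of a CONSTANT at the fixed family `J = dk − 1` (prescribing legs only drops terms; the level gain in the unit
is `(√2)^{tJ} ≤ 4^J`):

* §1 `hubbardSectorKernelNorm_le_of_pinned` (any family `F`, any `T`: the sectorised `L¹–L^∞` norm over ANY tuple set is dominated by a common bound `B` of the
  plain one-pinned sums `ε^{m−1}Σ_{X : X q = w}‖kernel (map E(F) T) m X‖`), `klLevNormOf_le_of_pinned`, `klLevNormOf_le_of_wtPinned` (`klScaleWt ≥ 1`);
* §2 `klTowerMeasLev_le_of_wtPinned` (every level `F`), `klLevUnit_eq_zero_track_div`, **`klTowerMuLevAt_le_of_wtPinned`**, **`klTowerMuLev_le_of_wtPinned`**: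
  `klTowerMuLev … d k m ≤ 27⁵·4^{dk−1}·B(2m)/klLevUnit … 0 m (dk−1)` whenever every `klWtPinnedSumAt … (dk−1) j (2m) (klTowerInput … d k) q w ≤ B(2m)`;
* §3 **`klTowerMuLev_le_profile_of_wtPinned`** — with a grid-step-shaped bound `B(2m) = ε^{2m−1}·A·P^m` the array has the law's profile
  `klTowerMuLev … d k m ≤ A′·λ^{m−1}·Q′^m`, `A′ = 27⁵·2^{7J}·A·λ`, `Q′ = P/(8^J·λ)` (`J = dk−1`; at `k = 1` this is the NAMED base profile of the re-based law).
Compositions of landed definitions and real algebra; nothing about the model is asserted beyond them; nothing asserts (ℓ), any stub, K3 or superconductivity.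
References: BGM 2006 §2.8 (2.83), (2.93)–(2.98), Lemma 2.5 [cite: BenfattoGiulianiMastropietro2006].
-/

noncomputable section

namespace Summit.HubbardSuperconductivity.HubbardSuperconductivity.Theorems.EngineV8

set_option linter.dupNamespace false -- summit = problem name (single-conjunct summit), D-0017

open Classical
open Real Finset Literature.MathematicalPhysics.QuantumLattice Literature.Probability.LatticeModels GrassmannAlgebra
open Literature.MathematicalPhysics.QuantumLattice.FermiRG
open Summit.HubbardSuperconductivity.HubbardSuperconductivity.Theorems.KLRegimeSplit
open Summit.HubbardSuperconductivity.HubbardSuperconductivity.Theorems.KLProgrammeLegKernels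
open Summit.HubbardSuperconductivity.HubbardSuperconductivity.Theorems.DispersionFlow

variable {L M : ℕ} [NeZero L] [NeZero M]

/-! ## §1 Sectorised norms from plain one-pinned sums -/

omit [NeZero M] in
/-- **Any sectorised `L¹–L^∞` norm is dominated by a common bound of the plain one-pinned sums**: for every family `F`, tuple set `A`, action `T`, degree `m ≥ 1`,
if `ε^{m−1}·Σ_{X : X q = w} ‖kernel (map E(F) T) m X‖ ≤ B` for all pins `(q, w)` (`0 ≤ B`, `β ≥ 0`), then `hubbardSectorKernelNorm β F A T ≤ B`
(`kernel_map_sectorAnalysis` + the label/position relabelling `sum_pinned_prod_eq`; a tuple set only drops terms). [folklore] -/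
theorem hubbardSectorKernelNorm_le_of_pinned {N : ℕ} {β : ℝ} (hβ : 0 ≤ β) (F : Fin N → FreqMomentum L M → ℂ) (T : HubbardGrassmann L M) {m : ℕ} (hm : 1 ≤ m)
    (A : Finset (Fin m → SectorLeg N)) {B : ℝ} (hB : 0 ≤ B)
    (h : ∀ (q : Fin m) (w : SpaceTimeIdx L M × SectorLeg N),
      imagTimeWeight β M ^ (m - 1) * ∑ X ∈ univ.filter (fun X : Fin m → SpaceTimeIdx L M × SectorLeg N => X q = w),
        ‖kernel ℂ (ExteriorAlgebra.map (Matrix.toLin' (sectorAnalysisMatrix L M β F)) T) m X‖ ≤ B) :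
    hubbardSectorKernelNorm L M β F A T ≤ B := by
  have hε : 0 ≤ imagTimeWeight β M := imagTimeWeight_nonneg hβ M
  refine (sectorisedKernelNorm_mono_set hε (subset_univ A) _).trans ?_
  obtain ⟨n, rfl⟩ : ∃ n, m = n + 1 := ⟨m - 1, by omega⟩
  refine sectorisedKernelNorm_le_of_forall_le hB fun p s y => ?_
  rw [sectorLegSum_def, ← mul_sum]
  have hR : ∑ X ∈ univ.filter (fun X : Fin (n + 1) → SpaceTimeIdx L M × SectorLeg N => X p = (y, s)),
        ‖kernel ℂ (ExteriorAlgebra.map (Matrix.toLin' (sectorAnalysisMatrix L M β F)) T) (n + 1) X‖ =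
      ∑ σ ∈ univ.filter (fun σ : Fin (n + 1) → SectorLeg N => σ p = s), ∑ x ∈ univ.filter (fun x : Fin (n + 1) → SpaceTimeIdx L M => x p = y),
          ‖sectorisedKernel L M β F T (n + 1) σ x‖ := by
    rw [← sum_pinned_prod_eq (fun x σ => ‖sectorisedKernel L M β F T (n + 1) σ x‖) p y s]
    refine sum_congr rfl fun Y _ => ?_
    rw [kernel_map_sectorAnalysis]
  rw [← hR]
  have h' := h p (y, s)
  rwa [Nat.add_sub_cancel] at h'

omit [NeZero M] in
/-- **The levelled norm from plain one-pinned sums** (any prescription `Ωe`): `klLevNormOf … J m T Ωe ≤ B`. [folklore] -/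
theorem klLevNormOf_le_of_pinned {β : ℝ} (hβ : 0 ≤ β) (μ : ℝ) (K : TrigPolyC4v) (J : ℕ) (T : HubbardGrassmann L M) {m : ℕ} (hm : 1 ≤ m)
    (Ωe : Fin m → Option (SectorLeg (sectorCount J))) {B : ℝ} (hB : 0 ≤ B)
    (h : ∀ (q : Fin m) (w : SpaceTimeIdx L M × SectorLeg (sectorCount J)),
      imagTimeWeight β M ^ (m - 1) * ∑ X ∈ univ.filter (fun X : Fin m → SpaceTimeIdx L M × SectorLeg (sectorCount J) => X q = w),
        ‖kernel ℂ (ExteriorAlgebra.map (Matrix.toLin' (sectorAnalysisMatrix L M β (klAnisoFamily L M β μ K klE0 J))) T) m X‖ ≤ B) :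
    klLevNormOf L M β μ K J m T Ωe ≤ B := by
  rw [klLevNormOf]
  exact hubbardSectorKernelNorm_le_of_pinned hβ _ T hm _ hB h

omit [NeZero M] in
/-- **The levelled norm from WEIGHTED one-pinned sums** (`klScaleWt ≥ 1`): if `klWtPinnedSumAt … J j m T q w ≤ B` for all pins, then `klLevNormOf … J m T Ωe ≤ B`. [folklore] -/
theorem klLevNormOf_le_of_wtPinned {β : ℝ} (hβ : 0 ≤ β) (μ : ℝ) (K : TrigPolyC4v) (J j : ℕ) (T : HubbardGrassmann L M) {m : ℕ} (hm : 1 ≤ m)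
    (Ωe : Fin m → Option (SectorLeg (sectorCount J))) {B : ℝ} (hB : 0 ≤ B)
    (h : ∀ (q : Fin m) (w : SpaceTimeIdx L M × SectorLeg (sectorCount J)), klWtPinnedSumAt L M β μ K J j m T q w ≤ B) :
    klLevNormOf L M β μ K J m T Ωe ≤ B := by
  have hε : 0 ≤ imagTimeWeight β M := imagTimeWeight_nonneg hβ M
  refine klLevNormOf_le_of_pinned hβ μ K J T hm Ωe hB fun q w => le_trans ?_ (h q w)
  unfold klWtPinnedSumAt
  refine mul_le_mul_of_nonneg_left (sum_le_sum fun X _ => ?_) (pow_nonneg hε _)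
  exact le_mul_of_one_le_left (norm_nonneg _) (one_le_klScaleWt L M β j _)

/-! ## §2 The measured levelled arrays of a block's input from weighted one-pinned sums at the input family -/

omit [NeZero M] in
/-- **Every level of the measured array is dominated by a common bound of the weighted one-pinned sums of the block's input at `F_{dk−1}`**:
`klTowerMeasLev … d k m F ≤ B`. [folklore] -/
theorem klTowerMeasLev_le_of_wtPinned {β : ℝ} (hβ : 0 ≤ β) (U μ : ℝ) (K : TrigPolyC4v) (d k j : ℕ) {m : ℕ} (hm : 1 ≤ m) (F : ℕ) {B : ℝ} (hB : 0 ≤ B)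
    (h : ∀ (q : Fin m) (w : SpaceTimeIdx L M × SectorLeg (sectorCount (d * k - 1))),
      klWtPinnedSumAt L M β μ K (d * k - 1) j m (klTowerInput L M β U μ K d k) q w ≤ B) :
    klTowerMeasLev L M β U μ K d k m F ≤ B := by
  unfold klTowerMeasLev
  rcases isEmpty_or_nonempty {Ωe : Fin m → Option (SectorLeg (sectorCount (d * k - 1))) // levelCount Ωe = F} with hE | hE
  · rw [Real.iSup_of_isEmpty]; exact hB
  · exact ciSup_le fun Ωe => klLevNormOf_le_of_wtPinned hβ μ K _ j _ hm Ωe.1 hB h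

omit [NeZero L] [NeZero M] in
/-- **The unit of track `t` is the track-`0` unit divided by the level gain**: `klLevUnit β M t p J = klLevUnit β M 0 p J / (√2)^{tJ}`. [folklore] -/
theorem klLevUnit_eq_zero_track_div (β : ℝ) (t : Fin 5) (p J : ℕ) :
    klLevUnit β M t p J = klLevUnit β M 0 p J / Real.sqrt 2 ^ ((t : ℕ) * J) := by
  unfold klLevUnit
  simp only [Fin.val_zero, zero_mul, pow_zero, mul_one]
  rw [div_div]

omit [NeZero L] [NeZero M] in
/-- The level gain of any track is at most `4^J`: `(√2)^{tJ} ≤ 4^J` for `t ≤ 4`. [folklore] -/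
theorem sqrt_two_pow_track_le (t : Fin 5) (J : ℕ) : Real.sqrt 2 ^ ((t : ℕ) * J) ≤ (4 : ℝ) ^ J := by
  have h4 : Real.sqrt 2 ^ 4 = 4 := by
    rw [show (4 : ℕ) = 2 * 2 by norm_num, pow_mul, Real.sq_sqrt (by norm_num : (0 : ℝ) ≤ 2)]; norm_num
  calc Real.sqrt 2 ^ ((t : ℕ) * J) ≤ Real.sqrt 2 ^ (4 * J) :=
        pow_le_pow_right₀ (Real.one_le_sqrt.2 (by norm_num)) (Nat.mul_le_mul_right J (by have := t.isLt; omega))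
    _ = (4 : ℝ) ^ J := by rw [pow_mul, h4]

/-- **The per-track measured array from weighted one-pinned sums**: `klTowerMuLevAt … d t k m ≤ 27⁵·4^{dk−1}·B/klLevUnit … 0 m (dk−1)` whenever every
`klWtPinnedSumAt … (dk−1) j (2m) (klTowerInput … d k) q w ≤ B` (`m ≥ 1`, `0 ≤ B`, `β > 0`). [cite: BenfattoGiulianiMastropietro2006, §2.8 (2.83), (2.93)-(2.98)] -/
theorem klTowerMuLevAt_le_of_wtPinned {β : ℝ} (hβ : 0 < β) (U μ : ℝ) (K : TrigPolyC4v) (d k j : ℕ) {m : ℕ} (hm : 1 ≤ m) {B : ℝ} (hB : 0 ≤ B)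
    (h : ∀ (q : Fin (2 * m)) (w : SpaceTimeIdx L M × SectorLeg (sectorCount (d * k - 1))),
      klWtPinnedSumAt L M β μ K (d * k - 1) j (2 * m) (klTowerInput L M β U μ K d k) q w ≤ B) (t : Fin 5) :
    klTowerMuLevAt L M β U μ K d t k m ≤ (27 : ℝ) ^ 5 * (4 : ℝ) ^ (d * k - 1) * B / klLevUnit β M 0 m (d * k - 1) := by
  have hu0 : 0 < klLevUnit β M 0 m (d * k - 1) := klLevUnit_pos hβ 0 m _
  have hut : 0 < klLevUnit β M t m (d * k - 1) := klLevUnit_pos hβ t m _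
  have hs0 : 0 < Real.sqrt 2 ^ ((t : ℕ) * (d * k - 1)) := by positivity
  have hmeas : klTowerMeasLev L M β U μ K d k (2 * m) ((t : ℕ) + 1) ≤ B :=
    klTowerMeasLev_le_of_wtPinned hβ.le U μ K d k j (by omega) _ hB h
  have h27 : (27 : ℝ) ^ ((t : ℕ) + 1) ≤ 27 ^ 5 := pow_le_pow_right₀ (by norm_num) (by have := t.isLt; omega)
  unfold klTowerMuLevAt
  rw [klLevUnit_eq_zero_track_div β t m (d * k - 1), div_div_eq_mul_div, div_le_div_iff_of_pos_right hu0]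
  calc (27 : ℝ) ^ ((t : ℕ) + 1) * klTowerMeasLev L M β U μ K d k (2 * m) ((t : ℕ) + 1) * Real.sqrt 2 ^ ((t : ℕ) * (d * k - 1))
      ≤ 27 ^ 5 * B * (4 : ℝ) ^ (d * k - 1) := by
        refine mul_le_mul (mul_le_mul h27 hmeas (klTowerMeasLev_nonneg hβ.le U μ K d k _ _) (by positivity)) (sqrt_two_pow_track_le t _)
          hs0.le (by positivity)
    _ = (27 : ℝ) ^ 5 * (4 : ℝ) ^ (d * k - 1) * B := by ring

/-- **THE TRACK-BLIND MEASURED ARRAY FROM WEIGHTED ONE-PINNED SUMS AT THE INPUT FAMILY**: `klTowerMuLev … d k m ≤ 27⁵·4^{dk−1}·B/klLevUnit … 0 m (dk−1)`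
(`m ≥ 1`). At `k = 1` (`J = d−1`): the levelled base datum of the re-based tower from the plain sizes of `𝒱_d` at `F_{d−1}`.
[cite: BenfattoGiulianiMastropietro2006, §2.8 (2.83), (2.93)-(2.98)] -/
theorem klTowerMuLev_le_of_wtPinned {β : ℝ} (hβ : 0 < β) (U μ : ℝ) (K : TrigPolyC4v) (d k j : ℕ) {m : ℕ} (hm : 1 ≤ m) {B : ℝ} (hB : 0 ≤ B)
    (h : ∀ (q : Fin (2 * m)) (w : SpaceTimeIdx L M × SectorLeg (sectorCount (d * k - 1))),
      klWtPinnedSumAt L M β μ K (d * k - 1) j (2 * m) (klTowerInput L M β U μ K d k) q w ≤ B) :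
    klTowerMuLev L M β U μ K d k m ≤ (27 : ℝ) ^ 5 * (4 : ℝ) ^ (d * k - 1) * B / klLevUnit β M 0 m (d * k - 1) := by
  obtain ⟨t, ht⟩ := exists_klTowerMuLev_eq (L := L) (M := M) β U μ K d k m
  rw [ht]
  exact klTowerMuLevAt_le_of_wtPinned hβ U μ K d k j hm hB h t

/-! ## §3 The law's profile form -/

omit [NeZero L] [NeZero M] in
/-- The track-`0` unit in closed form: `klLevUnit β M 0 m J = ε^{2m−1}·8^{Jm}/2^{5J}`. [folklore] -/
theorem klLevUnit_zero_track (β : ℝ) (m J : ℕ) :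
    klLevUnit β M 0 m J = imagTimeWeight β M ^ (2 * m - 1) * (8 : ℝ) ^ (J * m) / (2 : ℝ) ^ (5 * J) := by
  unfold klLevUnit
  simp only [Fin.val_zero, zero_mul, pow_zero, mul_one]

/-- **THE BASE PROFILE IN THE LAW's SHAPE**: if the weighted one-pinned sums of the block's input at `F_{dk−1}` obey a grid-step-shaped bound
`klWtPinnedSumAt … (2m) … ≤ ε^{2m−1}·A·P^m` for `m ≥ 1` (`A, P ≥ 0`), then for every `λ > 0` and `m ≥ 1`
`klTowerMuLev … d k m ≤ A′·λ^{m−1}·Q′^m` with `A′ = 27⁵·2^{7J}·A·λ`, `Q′ = P/(8^J·λ)`, `J = dk − 1`.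
[cite: BenfattoGiulianiMastropietro2006, §2.8 (2.83), (2.93)-(2.98)] -/
theorem klTowerMuLev_le_profile_of_wtPinned {β : ℝ} (hβ : 0 < β) (U μ : ℝ) (K : TrigPolyC4v) (d k j : ℕ) {A P : ℝ} (hA : 0 ≤ A) (hP : 0 ≤ P)
    (h : ∀ m, 1 ≤ m → ∀ (q : Fin (2 * m)) (w : SpaceTimeIdx L M × SectorLeg (sectorCount (d * k - 1))),
      klWtPinnedSumAt L M β μ K (d * k - 1) j (2 * m) (klTowerInput L M β U μ K d k) q w ≤ imagTimeWeight β M ^ (2 * m - 1) * A * P ^ m)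
    {lam : ℝ} (hlam : 0 < lam) {m : ℕ} (hm : 1 ≤ m) :
    klTowerMuLev L M β U μ K d k m ≤
      ((27 : ℝ) ^ 5 * (2 : ℝ) ^ (7 * (d * k - 1)) * A * lam) * lam ^ (m - 1) * (P / ((8 : ℝ) ^ (d * k - 1) * lam)) ^ m := by
  have hx : 0 < imagTimeWeight β M := by
    unfold imagTimeWeight
    have : (0 : ℝ) < M := Nat.cast_pos.2 (Nat.pos_of_ne_zero (NeZero.ne M))
    positivity
  set J := d * k - 1 with hJ
  have hB : 0 ≤ imagTimeWeight β M ^ (2 * m - 1) * A * P ^ m := by positivity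
  have hmain := klTowerMuLev_le_of_wtPinned hβ U μ K d k j hm hB (h m hm)
  refine hmain.trans (le_of_eq ?_)
  rw [← hJ, klLevUnit_zero_track]
  have hε : imagTimeWeight β M ^ (2 * m - 1) ≠ 0 := (pow_pos hx _).ne'
  have hl0 : lam ≠ 0 := hlam.ne'
  have h80 : (8 : ℝ) ^ J ≠ 0 := by positivity
  have h20 : (2 : ℝ) ^ (5 * J) ≠ 0 := by positivity
  have h27 : (2 : ℝ) ^ (7 * J) = (2 : ℝ) ^ (5 * J) * (4 : ℝ) ^ J := by
    rw [show (4 : ℝ) = 2 ^ 2 by norm_num, ← pow_mul, ← pow_add]; ring_nf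
  obtain ⟨n, rfl⟩ : ∃ n, m = n + 1 := ⟨m - 1, by omega⟩
  rw [Nat.add_sub_cancel, h27, show (8 : ℝ) ^ (J * (n + 1)) = ((8 : ℝ) ^ J) ^ (n + 1) by rw [pow_mul], div_pow, mul_pow ((8 : ℝ) ^ J)]
  rw [div_div_eq_mul_div, div_eq_iff (mul_ne_zero hε (pow_ne_zero _ h80))]
  field_simp
  ring

end Summit.HubbardSuperconductivity.HubbardSuperconductivity.Theorems.EngineV8

end
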